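import Literature.AlgebraicGeometry.Frobenioids.PerfectionFactorization
import Literature.AlgebraicGeometry.Frobenioids.PerfectionIsos
import Literature.AlgebraicGeometry.Frobenioids.PerfectionEndomorphisms
import HarnessLib

/-!
# Frobenioids I, Proposition 3.2 (ii) AS PRINTED, for THE perfection: an arrow of `C^pf` belongs to one of the
# ten printed classes iff a cofinal collection of the arrows of `C` determining it does (PROOFS)

Mochizuki, *The geometry of Frobenioids I: the general theory*, Kyushu J. Math. **62** (2008)
293–400, Proposition 3.2 (ii) p. 59 [cite: MochizukiFrdI2008, Prop. 3.2 (ii) p.59]: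
"An arrow of `C^pf` is a(n) morphism of Frobenius type (respectively, pre-step; base-isomorphism; base-identity
endomorphism; isomorphism; pull-back morphism; isometry; co-angular morphism; LB-invertible morphism;
morphism of a given Frobenius degree) if and only if a cofinal collection of the system of arrows of `C` that
determine this arrow of `C^pf` [cf. Definition 3.1, (ii)] is so."

The cell's typed `Prop32ii` (`BaseCategoryTheoreticityDefs.lean`) records the direction "`C → C^pf` preserves
these classes" (DISCHARGED: `prop32ii_perfection`, `prop32ii_rest_perfection`).  This file proves the printed
bi-implication for an ARBITRARY perfected morphism `[r]`, class by class, rendering "a cofinal collection … is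
so" as "all transports of the representative `r` to the levels above some level are so" (all ten classes are
stable under transport to higher levels — Prop. 1.10 (i) — so this IS the existence of a cofinal sub-collection
with the property).  The isomorphism clause is `isIso_mk_iff_cofinal` (`PerfectionIsos.lean`).  For
Frobenius degree, pre-steps, base-isomorphisms, isometries and base-identity endomorphisms EVERY
representative reflects the class (the representative dictionary of `PerfectionPreSteps.lean`,
`PerfectionEndomorphisms.lean`); for co-angular, LB-invertible and Frobenius-type arrows and pull-back morphisms
the "only if" direction uses the standing hypothesis of §3 (Frobenius-isotropic type): above an aligned level the
domains `A^{(a)}` of the transports are isotropic (Def. 1.3 (vii)(b)), so every transport is co-angular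
(Prop. 1.4 (i)), and a pull-back morphism of `C^pf` is LB-invertible and linear (Def. 1.3 (iv)(b) for `C^pf`,
`iv_b_perfection`, seat abc-iut-w5-d246), whence its transports are pull-back morphisms of `C` (Prop. 1.4 (ii)).
No new definitions; nothing here is specific to the abc programme.
-/

namespace Literature.AlgebraicGeometry.Frobenioids

namespace PreFrobenioid

namespace Perfection

open CategoryTheory Opposite

universe w v v' u u'

variable {D : Type u} [Category.{v} D] {Φ : Dᵒᵖ ⥤ CommMonCat.{w}}
  {C : Type u'} [Category.{v'} C] {F : C ⥤ ElemFrobenioid Φ} {hF : IsFrobenioid F}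
  {X Y : Perfection hF}

/-! ### The generic pattern: classes reflected by every representative -/

/-- If a property of the class `[r]` is equivalent to a property of EVERY transport of `r`, then it holds iff it
holds for a cofinal collection of transports. [cite: MochizukiFrdI2008, Prop. 3.2 (ii) p.59] -/
theorem iff_cofinal_of_forall_iff (r : Rep X Y) {Q : Prop} {P : ∀ ⦃A B : C⦄, (A ⟶ B) → Prop}
    (h : ∀ (L : Level X Y) (hL : r.L.LE L), Q ↔ P (Level.lift r.L L hL r.hom)) :
    Q ↔ ∃ (N : Level X Y) (hN : r.L.LE N), ∀ (L : Level X Y) (hL : N.LE L), P (Level.lift r.L L (hN.trans hL) r.hom) :=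
  ⟨fun q => ⟨r.L, r.L.le_rfl, fun L _ => (h L _).mp q⟩, fun ⟨N, hN, hall⟩ => (h N hN).mpr (hall N N.le_rfl)⟩

/-! ### Frobenius degree, pre-steps, base-isomorphisms, isometries -/

/-- **Prop. 3.2 (ii), "morphism of a given Frobenius degree"**: `[r]` has Frobenius degree `d` iff a cofinal
collection of its determining arrows does. [cite: MochizukiFrdI2008, Prop. 3.2 (ii) p.59] -/
theorem hasDegree_mk_iff_cofinal (r : Rep X Y) (d : ℕ+) :
    (ops hF).HasDegree d (X := X) (Y := Y) (Hom.mk r) ↔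
      ∃ (N : Level X Y) (hN : r.L.LE N), ∀ (L : Level X Y) (hL : N.LE L),
        degFr F (Level.lift r.L L (hN.trans hL) r.hom) = d :=
  iff_cofinal_of_forall_iff r (P := fun _ _ φ => degFr F φ = d) fun L hL => by
    rw [← Hom.mk_lift r L hL, hasDegree_mk_iff]

/-- **Prop. 3.2 (ii), "pre-step"**. [cite: MochizukiFrdI2008, Prop. 3.2 (ii) p.59] -/
theorem isPreStep_mk_iff_cofinal (r : Rep X Y) :
    (ops hF).IsPreStep (X := X) (Y := Y) (Hom.mk r) ↔
      ∃ (N : Level X Y) (hN : r.L.LE N), ∀ (L : Level X Y) (hL : N.LE L),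
        IsPreStep F (Level.lift r.L L (hN.trans hL) r.hom) :=
  iff_cofinal_of_forall_iff r (P := fun _ _ φ => IsPreStep F φ) fun L hL => by
    rw [isPreStep_lift_iff r L hL, isPreStep_mk_iff]

/-- **Prop. 3.2 (ii), "base-isomorphism"**. [cite: MochizukiFrdI2008, Prop. 3.2 (ii) p.59] -/
theorem isBaseIso_mk_iff_cofinal (r : Rep X Y) :
    (ops hF).IsBaseIso (X := X) (Y := Y) (Hom.mk r) ↔
      ∃ (N : Level X Y) (hN : r.L.LE N), ∀ (L : Level X Y) (hL : N.LE L),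
        IsBaseIso F (Level.lift r.L L (hN.trans hL) r.hom) :=
  iff_cofinal_of_forall_iff r (P := fun _ _ φ => IsBaseIso F φ) fun L hL => by
    rw [isBaseIso_lift_iff r L hL, isBaseIso_mk_iff]

/-- **Prop. 3.2 (ii), "isometry"**. [cite: MochizukiFrdI2008, Prop. 3.2 (ii) p.59] -/
theorem isIsometry_mk_iff_cofinal (r : Rep X Y) :
    (ops hF).IsIsometry (X := X) (Y := Y) (Hom.mk r) ↔
      ∃ (N : Level X Y) (hN : r.L.LE N), ∀ (L : Level X Y) (hL : N.LE L),
        IsIsometry F (Level.lift r.L L (hN.trans hL) r.hom) :=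
  iff_cofinal_of_forall_iff r (P := fun _ _ φ => IsIsometry F φ) fun L hL => by
    rw [isIsometry_lift_iff r L hL, isIsometry_mk_iff]

/-! ### Base-identity endomorphisms (diagonal levels) -/

/-- **Prop. 3.2 (ii), "base-identity endomorphism"**: the class `[θ]` of an endomorphism `θ` of `A^{(c)}` is a
base-identity endomorphism of `(A, n)` iff a cofinal collection of the transports of `θ` (to the diagonal levels
`(c', c')`, `c ∣ c'`) consists of base-identity endomorphisms. [cite: MochizukiFrdI2008, Prop. 3.2 (ii) p.59] -/
theorem isBaseIdentity_endClass_iff_cofinal (X : Perfection hF) (c : ℕ+)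
    (θ : frobPow hF X.obj c ⟶ frobPow hF X.obj c) :
    (ops hF).IsBaseIdentity (endClass X c θ) ↔
      ∃ (N : ℕ+) (hN : c ∣ N), ∀ (c' : ℕ+) (hc' : N ∣ c'),
        IsBaseIdentity F (liftLevel hF θ (hN.trans hc') (hN.trans hc') rfl) := by
  constructor
  · intro h
    refine ⟨c, dvd_rfl, fun c' hc' => ?_⟩
    rw [← isBaseIdentity_endClass_iff X c', endClass_liftLevel]
    exact h
  · rintro ⟨N, hN, hall⟩
    rw [← endClass_liftLevel X hN θ rfl, isBaseIdentity_endClass_iff]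
    exact hall N dvd_rfl

/-! ### Aligned isotropic levels (the standing hypothesis of §3) -/

/-- For `C` of Frobenius-isotropic type, above some level all transports of a representative have ISOTROPIC
domain `A^{(a)}` (Def. 1.3 (ii), (vii)(b)), hence are co-angular arrows of `C` (Prop. 1.4 (i)).
[cite: MochizukiFrdI2008, Prop. 1.4 (i) p.25] -/
theorem exists_level_forall_isCoAngular_lift (hiso : IsOfType (IsFrobeniusIsotropic F)) (r : Rep X Y) :
    ∃ (N : Level X Y) (hN : r.L.LE N), ∀ (L : Level X Y) (hL : N.LE L),
      IsCoAngular F (Level.lift r.L L (hN.trans hL) r.hom) := by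
  obtain ⟨A', φ₀, hφ₀, hA'⟩ := hiso X.obj
  refine ⟨⟨r.L.a * degFr F φ₀, r.L.b * degFr F φ₀, by rw [← mul_assoc, r.L.eq, mul_assoc]⟩,
    ⟨dvd_mul_right _ _, dvd_mul_right _ _⟩, fun L hL => ?_⟩
  have hd : degFr F φ₀ ∣ L.a := (dvd_mul_left _ _).trans hL.1
  exact isCoAngular_of_isIsotropic_codomains F _ fun _ g => hF.vii_b g (isIsotropic_frobPow hF hφ₀ hA' hd)

/-! ### Co-angular, LB-invertible, Frobenius type -/

/-- **Prop. 3.2 (ii), "co-angular morphism"** (for `C` of Frobenius-isotropic type).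
[cite: MochizukiFrdI2008, Prop. 3.2 (ii) p.59] -/
theorem isCoAngular_mk_iff_cofinal (hiso : IsOfType (IsFrobeniusIsotropic F)) (r : Rep X Y) :
    (ops hF).IsCoAngular (X := X) (Y := Y) (Hom.mk r) ↔
      ∃ (N : Level X Y) (hN : r.L.LE N), ∀ (L : Level X Y) (hL : N.LE L),
        IsCoAngular F (Level.lift r.L L (hN.trans hL) r.hom) := by
  refine ⟨fun _ => exists_level_forall_isCoAngular_lift hiso r, ?_⟩
  rintro ⟨N, hN, hall⟩
  rw [← Hom.mk_lift r N hN]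
  refine isCoAngular_mk ⟨N, Level.lift r.L N hN r.hom⟩ fun L hL => ?_
  change IsCoAngular F (Level.lift N L hL (Level.lift r.L N hN r.hom))
  rw [Level.lift_trans hN hL]
  exact hall L hL

/-- **Prop. 3.2 (ii), "LB-invertible morphism"** (for `C` of Frobenius-isotropic type).
[cite: MochizukiFrdI2008, Prop. 3.2 (ii) p.59] -/
theorem isLBInvertible_mk_iff_cofinal (hiso : IsOfType (IsFrobeniusIsotropic F)) (r : Rep X Y) :
    (ops hF).IsLBInvertible (X := X) (Y := Y) (Hom.mk r) ↔
      ∃ (N : Level X Y) (hN : r.L.LE N), ∀ (L : Level X Y) (hL : N.LE L),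
        IsLBInvertible F (Level.lift r.L L (hN.trans hL) r.hom) := by
  constructor
  · rintro ⟨-, hiso'⟩
    obtain ⟨N, hN, hall⟩ := exists_level_forall_isCoAngular_lift hiso r
    exact ⟨N, hN, fun L hL => ⟨hall L hL, (isIsometry_lift_iff r L _).mpr ((isIsometry_mk_iff r).mp hiso')⟩⟩
  · rintro ⟨N, hN, hall⟩
    exact ⟨(isCoAngular_mk_iff_cofinal hiso r).mpr ⟨N, hN, fun L hL => (hall L hL).1⟩,
      (isIsometry_mk_iff r).mpr ((isIsometry_lift_iff r N hN).mp (hall N N.le_rfl).2)⟩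

/-- **Prop. 3.2 (ii), "morphism of Frobenius type"** (for `C` of Frobenius-isotropic type).
[cite: MochizukiFrdI2008, Prop. 3.2 (ii) p.59] -/
theorem isFrobeniusType_mk_iff_cofinal (hiso : IsOfType (IsFrobeniusIsotropic F)) (r : Rep X Y) :
    (ops hF).IsFrobeniusType (X := X) (Y := Y) (Hom.mk r) ↔
      ∃ (N : Level X Y) (hN : r.L.LE N), ∀ (L : Level X Y) (hL : N.LE L),
        IsFrobeniusType F (Level.lift r.L L (hN.trans hL) r.hom) := by
  constructor
  · rintro ⟨hlb, hbi⟩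
    obtain ⟨N, hN, hall⟩ := (isLBInvertible_mk_iff_cofinal hiso r).mp hlb
    exact ⟨N, hN, fun L hL => ⟨hall L hL, (isBaseIso_lift_iff r L _).mpr ((isBaseIso_mk_iff r).mp hbi)⟩⟩
  · rintro ⟨N, hN, hall⟩
    rw [← Hom.mk_lift r N hN]
    exact isFrobeniusType_mk_of ⟨N, Level.lift r.L N hN r.hom⟩ (hall N N.le_rfl)

/-! ### Pull-back morphisms -/

/-- **Prop. 3.2 (ii), "pull-back morphism"** (for `C` of Frobenius-isotropic type): `[r]` is a pull-back
morphism of `C^pf` (over `D`) iff a cofinal collection of its determining arrows consists of pull-back morphisms of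
`C`.  "If": `isPullbackMorphism_mk_of` (seat abc-iut-w5-d246); "only if": a pull-back morphism of `C^pf` is
LB-invertible and linear (Def. 1.3 (iv)(b) for `C^pf`), so its transports above an aligned isotropic level are
LB-invertible linear arrows of `C`, i.e. pull-back morphisms (Prop. 1.4 (ii)).
[cite: MochizukiFrdI2008, Prop. 3.2 (ii) p.59] -/
theorem isPullbackMorphism_mk_iff_cofinal (hiso : IsOfType (IsFrobeniusIsotropic F)) (r : Rep X Y) :
    (ops hF).IsPullbackMorphism (Hom.mk r) ↔
      ∃ (N : Level X Y) (hN : r.L.LE N), ∀ (L : Level X Y) (hL : N.LE L),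
        PreFrobenioid.IsPullbackMorphism F (Level.lift r.L L (hN.trans hL) r.hom) := by
  constructor
  · intro h
    obtain ⟨hlb, hlin⟩ := iv_b_perfection hiso (Hom.mk r) h
    obtain ⟨N, hN, hall⟩ := (isLBInvertible_mk_iff_cofinal hiso r).mp hlb
    refine ⟨N, hN, fun L hL => (isPullbackMorphism_iff_isLBInvertible_isLinear F hF _).mpr ⟨hall L hL, ?_⟩⟩
    have hd := degFr_lift r.L L (hN.trans hL) r.hom
    change degFr F (Level.lift r.L L (hN.trans hL) r.hom) = degFr F r.hom at hd
    exact hd.trans ((isLinear_mk_iff r).mp hlin)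
  · rintro ⟨N, hN, hall⟩
    rw [← Hom.mk_lift r N hN]
    exact isPullbackMorphism_mk_of N.a N.b N.eq (Level.lift r.L N hN r.hom) (hall N N.le_rfl)

/-! ### Isomorphisms: `isIso_mk_iff_cofinal` (`PerfectionIsos.lean`, seat abc-iut-L1-d9) is the tenth clause. -/

end Perfection

end PreFrobenioid

end Literature.AlgebraicGeometry.Frobenioids
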